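import Summits.Ventures.Crystal3D.Theorems.StickyWulffConstantCoaxialWallLawEndUniqueTwoPlateGen
import HarnessLib

/-!
# LEMMA X″ at every version, two roots: bottom class of `r₁` vs top (basal-letter) class of `r₂`, `r₁ ≠ −r₂`
# (crux `CoaxialWallLaw`, stmt-Ventures-19481, line `WallLedgerF`; v2 transition, twin two-plate union)

HONEST FRAMING. Venture `Summits/Ventures/Crystal3D` (cell `crystal3d-full`), helper `--supports` the crux
`CoaxialWallLaw` of `route-Ventures-StickyWulffConstant` (REGISTERED line `WallLedgerF`).  Rung credit; F-C1 not
moved; pure word algebra.  `word_target_ne_twoPlate_shape` (`…EndUniqueTwoPlateGen`) with TWO in-plane roots: the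
bottom class is a chain all oblique to `r₁`, the top class a basal-letter chain `l₂ ++ [e]` with `l₂` oblique to `r₂`,
both roots orthogonal to `e`, and `r₁ ≠ −r₂` (rising in-plane roots are never antipodal; `r₁ = r₂` is allowed).  The
proof is the one-root proof verbatim; only the terminal case reads `r₁ = −r₂` instead of `r = −r`.  This is what the
twin two-plate row cell needs to pool the bottom plate's and the pulled-back top plate's typed end pairs at `v2`.

* **`word_target_ne_twoPlate_shape₂`**.  WHAT THIS IS NOT: the cell (next files); F-C1 not moved.
-/

noncomputable section

namespace Summit.Ventures.Crystal3D.Theorems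

open Summit.Ventures.Crystal3D Finset
open Literature.MathematicalPhysics.StatisticalMechanics (fccStacking)
open scoped InnerProductSpace

variable {F : List (EuclideanSpace ℝ (Fin 3)) → (EuclideanSpace ℝ (Fin 3) ≃ₗᵢ[ℝ] EuclideanSpace ℝ (Fin 3))}

/-- **LEMMA X″ (all versions, two roots): a bottom class of root `r₁` and a top (basal-letter) class of root `r₂`,
`r₁ ≠ −r₂` both orthogonal to the basal letter, never share a target.**  See the module docstring. -/
theorem word_target_ne_twoPlate_shape₂ (hFc : ∀ μ κ, F (μ :: κ) = ((ℝ ∙ μ)ᗮ.reflection).trans (F κ))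
    {κ₁ l₂ : List (EuclideanSpace ℝ (Fin 3))} {e r₁ r₂ : EuclideanSpace ℝ (Fin 3)}
    (hr₁ : r₁ ∈ fccSlots) (hr₂ : r₂ ∈ fccSlots) (hne : r₁ ≠ -r₂)
    (hκ₁ : ∀ μ ∈ κ₁, ‖μ‖ = 1 ∧
      ∀ w ∈ fccSlots, ⟪w, μ⟫_ℝ = 0 ∨ ⟪w, μ⟫_ℝ = Real.sqrt (2 / 3) ∨ ⟪w, μ⟫_ℝ = -Real.sqrt (2 / 3))
    (hch₁ : List.IsChain (fun μ μ' => ⟪μ, μ'⟫_ℝ = 1 / 3 ∨ ⟪μ, μ'⟫_ℝ = -1 / 3) κ₁)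
    (hob₁ : ∀ μ ∈ κ₁, ⟪r₁, μ⟫_ℝ = Real.sqrt (2 / 3) ∨ ⟪r₁, μ⟫_ℝ = -Real.sqrt (2 / 3))
    (he1 : ‖e‖ = 1)
    (hemenu : ∀ w ∈ fccSlots, ⟪w, e⟫_ℝ = 0 ∨ ⟪w, e⟫_ℝ = Real.sqrt (2 / 3) ∨ ⟪w, e⟫_ℝ = -Real.sqrt (2 / 3))
    (hre₁ : ⟪r₁, e⟫_ℝ = 0) (hre₂ : ⟪r₂, e⟫_ℝ = 0)
    (hl₂ : ∀ μ ∈ l₂, ‖μ‖ = 1 ∧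
      ∀ w ∈ fccSlots, ⟪w, μ⟫_ℝ = 0 ∨ ⟪w, μ⟫_ℝ = Real.sqrt (2 / 3) ∨ ⟪w, μ⟫_ℝ = -Real.sqrt (2 / 3))
    (hch₂ : List.IsChain (fun μ μ' => ⟪μ, μ'⟫_ℝ = 1 / 3 ∨ ⟪μ, μ'⟫_ℝ = -1 / 3) (l₂ ++ [e]))
    (hob₂ : ∀ μ ∈ l₂, ⟪r₂, μ⟫_ℝ = Real.sqrt (2 / 3) ∨ ⟪r₂, μ⟫_ℝ = -Real.sqrt (2 / 3))
    {d₁ d₂ : EuclideanSpace ℝ (Fin 3)} (hd₁ : d₁ = F κ₁ (((-1 : ℝ) ^ κ₁.length) • r₁))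
    (hd₂ : d₂ = F (l₂ ++ [e]) (((-1 : ℝ) ^ (l₂ ++ [e]).length) • r₂))
    {p t₁ t₂ : EuclideanSpace ℝ (Fin 3)}
    (hT₁ : t₁ = p + d₁ ∨ ∃ m : EuclideanSpace ℝ (Fin 3), ‖m‖ = 1 ∧
      (∀ w ∈ fccSlots, ⟪F κ₁ w, m⟫_ℝ = 0 ∨ ⟪F κ₁ w, m⟫_ℝ = Real.sqrt (2 / 3) ∨ ⟪F κ₁ w, m⟫_ℝ = -Real.sqrt (2 / 3)) ∧
      ⟪d₁, m⟫_ℝ = Real.sqrt (2 / 3) ∧ t₁ = p - (d₁ - (2 * ⟪d₁, m⟫_ℝ) • m))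
    (hT₂ : t₂ = p + d₂ ∨ ∃ m : EuclideanSpace ℝ (Fin 3), ‖m‖ = 1 ∧
      (∀ w ∈ fccSlots, ⟪F (l₂ ++ [e]) w, m⟫_ℝ = 0 ∨ ⟪F (l₂ ++ [e]) w, m⟫_ℝ = Real.sqrt (2 / 3) ∨
        ⟪F (l₂ ++ [e]) w, m⟫_ℝ = -Real.sqrt (2 / 3)) ∧
      ⟪d₂, m⟫_ℝ = Real.sqrt (2 / 3) ∧ t₂ = p - (d₂ - (2 * ⟪d₂, m⟫_ℝ) • m)) :
    t₁ ≠ t₂ := by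
  have hr0 : 0 < Real.sqrt (2 / 3) := Real.sqrt_pos.2 (by norm_num)
  -- obliqueness survives a sign, and sign bookkeeping `(-1)^(n ± 1) = -(-1)^n`
  have ob_smul : ∀ {r : EuclideanSpace ℝ (Fin 3)} {κ : List (EuclideanSpace ℝ (Fin 3))} (n : ℕ),
      (∀ μ ∈ κ, ⟪r, μ⟫_ℝ = Real.sqrt (2 / 3) ∨ ⟪r, μ⟫_ℝ = -Real.sqrt (2 / 3)) →
      ∀ μ ∈ κ, ⟪((-1 : ℝ) ^ n) • r, μ⟫_ℝ = Real.sqrt (2 / 3) ∨ ⟪((-1 : ℝ) ^ n) • r, μ⟫_ℝ = -Real.sqrt (2 / 3) := by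
    intro r κ n hob μ hμ
    rw [real_inner_smul_left]
    rcases neg_one_pow_eq_or ℝ n with h | h <;> rcases hob μ hμ with h' | h' <;> rw [h, h']
    · left; ring
    · right; ring
    · right; ring
    · left; ring
  have ob_of_smul : ∀ {r : EuclideanSpace ℝ (Fin 3)} {κ : List (EuclideanSpace ℝ (Fin 3))} (n : ℕ),
      (∀ μ ∈ κ, ⟪((-1 : ℝ) ^ n) • r, μ⟫_ℝ = Real.sqrt (2 / 3) ∨ ⟪((-1 : ℝ) ^ n) • r, μ⟫_ℝ = -Real.sqrt (2 / 3)) →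
      ∀ μ ∈ κ, ⟪r, μ⟫_ℝ = Real.sqrt (2 / 3) ∨ ⟪r, μ⟫_ℝ = -Real.sqrt (2 / 3) := by
    intro r κ n hob μ hμ
    have h0 := hob μ hμ
    rw [real_inner_smul_left] at h0
    rcases neg_one_pow_eq_or ℝ n with h | h <;> rw [h] at h0 <;> rcases h0 with h' | h'
    · left; linarith
    · right; linarith
    · right; linarith
    · left; linarith
  have pow_step : ∀ {a b : ℕ}, (a = b + 1 ∨ b = a + 1) → ((-1 : ℝ) ^ a) = -((-1 : ℝ) ^ b) := by
    rintro a b (rfl | rfl)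
    · rw [pow_succ]; ring
    · rw [pow_succ]; ring
  -- (A) the bottom target is `p + F κ₁' ((-1)^|κ₁'| • r₁)` for an all-oblique arrival chain `κ₁'`
  obtain ⟨κ₁', hκ₁', hch₁', hob₁', ht₁⟩ : ∃ κ₁' : List (EuclideanSpace ℝ (Fin 3)),
      (∀ μ ∈ κ₁', ‖μ‖ = 1 ∧
        ∀ w ∈ fccSlots, ⟪w, μ⟫_ℝ = 0 ∨ ⟪w, μ⟫_ℝ = Real.sqrt (2 / 3) ∨ ⟪w, μ⟫_ℝ = -Real.sqrt (2 / 3)) ∧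
      List.IsChain (fun μ μ' => ⟪μ, μ'⟫_ℝ = 1 / 3 ∨ ⟪μ, μ'⟫_ℝ = -1 / 3) κ₁' ∧
      (∀ μ ∈ κ₁', ⟪r₁, μ⟫_ℝ = Real.sqrt (2 / 3) ∨ ⟪r₁, μ⟫_ℝ = -Real.sqrt (2 / 3)) ∧
      t₁ = p + F κ₁' (((-1 : ℝ) ^ κ₁'.length) • r₁) := by
    rcases hT₁ with rfl | ⟨m, hm, hmenu, hdm, rfl⟩
    · exact ⟨κ₁, hκ₁, hch₁, hob₁, by rw [hd₁]⟩
    · have hcross : ⟪F κ₁ (((-1 : ℝ) ^ κ₁.length) • r₁), m⟫_ℝ = Real.sqrt (2 / 3) ∨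
          ⟪F κ₁ (((-1 : ℝ) ^ κ₁.length) • r₁), m⟫_ℝ = -Real.sqrt (2 / 3) := Or.inl (by rw [← hd₁]; exact hdm)
      obtain ⟨κ', hκ', hch', hob', heq, hlen⟩ :=
        word_dir_reflect_eq_len hFc hκ₁ hch₁ (ob_smul κ₁.length hob₁) hm hmenu hcross
      refine ⟨κ', hκ', hch', ob_of_smul κ₁.length hob', ?_⟩
      rw [hd₁, heq, pow_step hlen, neg_smul, map_neg, sub_eq_add_neg]
  -- (B) the top target is `p + F (l₂' ++ [e]) ((-1)^(|l₂'|+1) • r₂)` for a basal-letter arrival chain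
  obtain ⟨l₂', hl₂', hch₂', hob₂', ht₂⟩ : ∃ l₂' : List (EuclideanSpace ℝ (Fin 3)),
      (∀ μ ∈ l₂', ‖μ‖ = 1 ∧
        ∀ w ∈ fccSlots, ⟪w, μ⟫_ℝ = 0 ∨ ⟪w, μ⟫_ℝ = Real.sqrt (2 / 3) ∨ ⟪w, μ⟫_ℝ = -Real.sqrt (2 / 3)) ∧
      List.IsChain (fun μ μ' => ⟪μ, μ'⟫_ℝ = 1 / 3 ∨ ⟪μ, μ'⟫_ℝ = -1 / 3) (l₂' ++ [e]) ∧
      (∀ μ ∈ l₂', ⟪r₂, μ⟫_ℝ = Real.sqrt (2 / 3) ∨ ⟪r₂, μ⟫_ℝ = -Real.sqrt (2 / 3)) ∧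
      t₂ = p + F (l₂' ++ [e]) (((-1 : ℝ) ^ (l₂' ++ [e]).length) • r₂) := by
    rcases hT₂ with rfl | ⟨m, hm, hmenu, hdm, rfl⟩
    · exact ⟨l₂, hl₂, hch₂, hob₂, by rw [hd₂]⟩
    · have hxe : ⟪((-1 : ℝ) ^ (l₂ ++ [e]).length) • r₂, e⟫_ℝ = 0 := by rw [real_inner_smul_left, hre₂, mul_zero]
      have hcross : ⟪F (l₂ ++ [e]) (((-1 : ℝ) ^ (l₂ ++ [e]).length) • r₂), m⟫_ℝ = Real.sqrt (2 / 3) ∨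
          ⟪F (l₂ ++ [e]) (((-1 : ℝ) ^ (l₂ ++ [e]).length) • r₂), m⟫_ℝ = -Real.sqrt (2 / 3) :=
        Or.inl (by rw [← hd₂]; exact hdm)
      obtain ⟨l', hl', hch', hob', heq, hlen⟩ :=
        word_dir_reflect_eq_basal hFc hl₂ he1 hemenu hxe hch₂ (ob_smul (l₂ ++ [e]).length hob₂) hm hmenu hcross
      refine ⟨l', hl', hch', ob_of_smul (l₂ ++ [e]).length hob', ?_⟩
      have hlen' : (l' ++ [e]).length = (l₂ ++ [e]).length + 1 ∨ (l₂ ++ [e]).length = (l' ++ [e]).length + 1 := by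
        simp only [List.length_append, List.length_singleton]; omega
      rw [hd₂, heq, pow_step hlen', neg_smul, map_neg, sub_eq_add_neg]
  -- (C) equal targets ⇒ equal arrival directions ⇒ a forbidden mirror chain
  intro heqt
  rw [ht₁, ht₂] at heqt
  have hdir : F κ₁' (((-1 : ℝ) ^ κ₁'.length) • r₁) = F (l₂' ++ [e]) (((-1 : ℝ) ^ (l₂' ++ [e]).length) • r₂) :=
    add_left_cancel heqt
  have hu₁ : ∀ μ ∈ κ₁', ‖μ‖ = 1 := fun μ hμ => (hκ₁' μ hμ).1
  have hl₂'u : ∀ μ ∈ l₂', ‖μ‖ = 1 := fun μ hμ => (hl₂' μ hμ).1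
  have hu₂ : ∀ μ ∈ l₂' ++ [e], ‖μ‖ = 1 := by
    intro μ hμ
    rcases List.mem_append.1 hμ with h | h
    · exact hl₂'u μ h
    · rw [List.mem_singleton.1 h]; exact he1
  -- slots and obliqueness with the signs, then forget the exponents
  have hslot : ∀ {r : EuclideanSpace ℝ (Fin 3)}, r ∈ fccSlots → ∀ n : ℕ, ((-1 : ℝ) ^ n) • r ∈ fccSlots := by
    intro r hr n
    rcases neg_one_pow_eq_or ℝ n with h | h <;> rw [h]
    · rw [one_smul]; exact hr
    · rw [neg_one_smul]; exact neg_mem_fccSlots hr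
  have hs₁ := hslot hr₁ κ₁'.length
  have hs₂ := hslot hr₂ (l₂' ++ [e]).length
  have hobs₁ := ob_smul κ₁'.length hob₁'
  have hobs₂ := ob_smul (l₂' ++ [e]).length hob₂'
  have hc₁val : κ₁' = [] → ((-1 : ℝ) ^ κ₁'.length) = 1 := by intro h; rw [h, List.length_nil, pow_zero]
  have hc₂val : l₂' = [] → ((-1 : ℝ) ^ (l₂' ++ [e]).length) = -1 := by
    intro h; rw [h, List.nil_append, List.length_singleton, pow_one]
  generalize ((-1 : ℝ) ^ κ₁'.length) = c₁ at hs₁ hobs₁ hdir hc₁val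
  generalize ((-1 : ℝ) ^ (l₂' ++ [e]).length) = c₂ at hs₂ hobs₂ hdir hc₂val
  -- peel the base frame: `foldl κ₁' (c₁ r) = M_e (foldl l₂' (c₂ r))`
  have hfold : κ₁'.foldl (fun (y : EuclideanSpace ℝ (Fin 3)) μ => y - (2 * ⟪y, μ⟫_ℝ) • μ) (c₁ • r₁) =
      l₂'.foldl (fun (y : EuclideanSpace ℝ (Fin 3)) μ => y - (2 * ⟪y, μ⟫_ℝ) • μ) (c₂ • r₂) -
        (2 * ⟪l₂'.foldl (fun (y : EuclideanSpace ℝ (Fin 3)) μ => y - (2 * ⟪y, μ⟫_ℝ) • μ) (c₂ • r₂), e⟫_ℝ) • e := by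
    have e₁ := word_F_append_apply hFc κ₁' hu₁ [] (c₁ • r₁)
    have e₂ := word_F_append_apply hFc (l₂' ++ [e]) hu₂ [] (c₂ • r₂)
    rw [List.append_nil] at e₁ e₂
    rw [e₁, e₂] at hdir
    have := (F []).injective hdir
    simpa only [List.foldl_append, List.foldl_cons, List.foldl_nil] using this
  by_cases h1 : κ₁' = []
  · -- trivial bottom arrival chain: `c₁ = 1`
    rw [h1, List.foldl_nil, hc₁val h1, one_smul] at hfold
    -- `foldl l₂' (c₂ r₂) = M_e r₁ = r₁`
    have hfix : l₂'.foldl (fun (y : EuclideanSpace ℝ (Fin 3)) μ => y - (2 * ⟪y, μ⟫_ℝ) • μ) (c₂ • r₂) = r₁ := by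
      have h := reflect_reflect_unit he1
        (l₂'.foldl (fun (y : EuclideanSpace ℝ (Fin 3)) μ => y - (2 * ⟪y, μ⟫_ℝ) • μ) (c₂ • r₂))
      rw [← hfold, hre₁, mul_zero, zero_smul, sub_zero] at h
      exact h.symm
    by_cases h2 : l₂' = []
    · -- both trivial: `r₁ = -r₂`
      rw [h2, List.foldl_nil, hc₂val h2, neg_one_smul] at hfix
      exact hne hfix.symm
    · obtain ⟨ν, l₀, hl₀⟩ := List.exists_cons_of_ne_nil h2
      have hchl : List.IsChain (fun μ μ' => ⟪μ, μ'⟫_ℝ = 1 / 3 ∨ ⟪μ, μ'⟫_ℝ = -1 / 3) l₂' := hch₂'.left_of_append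
      rw [hl₀] at hfix hchl
      have key := foldl_reflect_not_mem_fcc ν l₀ (fun μ hμ => hl₂' μ (by rw [hl₀]; exact hμ)) hchl hs₂
        (hobs₂ ν (by rw [hl₀]; exact List.mem_cons_self))
      rw [hfix] at key
      exact key (mem_fcc_of_mem_fccSlots hr₁)
  · -- nonempty bottom arrival chain: glue `κ₁' ++ (e :: l₂'.reverse)`
    obtain ⟨μ₁, g, hg⟩ := List.exists_cons_of_ne_nil h1
    have hglue : (κ₁' ++ (e :: l₂'.reverse)).foldl (fun (y : EuclideanSpace ℝ (Fin 3)) μ => y - (2 * ⟪y, μ⟫_ℝ) • μ)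
        (c₁ • r₁) = c₂ • r₂ := by
      simp only [List.foldl_append, List.foldl_cons, hfold]
      rw [reflect_reflect_unit he1]
      exact foldl_reflect_reverse_foldl l₂' hl₂'u _
    have hletg : ∀ μ ∈ κ₁' ++ (e :: l₂'.reverse), ‖μ‖ = 1 ∧
        ∀ w ∈ fccSlots, ⟪w, μ⟫_ℝ = 0 ∨ ⟪w, μ⟫_ℝ = Real.sqrt (2 / 3) ∨ ⟪w, μ⟫_ℝ = -Real.sqrt (2 / 3) := by
      intro μ hμ
      rcases List.mem_append.1 hμ with h | h
      · exact hκ₁' μ h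
      · rcases List.mem_cons.1 h with rfl | h'
        · exact ⟨he1, hemenu⟩
        · exact hl₂' μ (List.mem_reverse.1 h')
    have hchg : List.IsChain (fun μ μ' => ⟪μ, μ'⟫_ℝ = 1 / 3 ∨ ⟪μ, μ'⟫_ℝ = -1 / 3) (κ₁' ++ (e :: l₂'.reverse)) := by
      rw [List.isChain_append]
      refine ⟨hch₁', ?_, ?_⟩
      · have : e :: l₂'.reverse = (l₂' ++ [e]).reverse := by
          rw [List.reverse_append, List.reverse_singleton, List.singleton_append]
        rw [this, List.isChain_reverse]
        exact hch₂'.imp fun a b h => by rw [real_inner_comm]; exact h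
      · intro x hx y hy
        rw [List.head?_cons, Option.mem_def, Option.some.injEq] at hy
        subst hy
        obtain ⟨hx1, hxm⟩ := hκ₁' x (List.mem_of_getLast? hx)
        have hxob := hob₁' x (List.mem_of_getLast? hx)
        refine menuNormals_chain_of_ne_of_ne_neg hx1 he1 hxm hemenu ?_ ?_
        · intro h; rw [h, hre₁] at hxob; rcases hxob with h' | h' <;> linarith
        · intro h
          have : ⟪r₁, x⟫_ℝ = 0 := by
            have := hre₁; rw [h, inner_neg_right, neg_eq_zero] at this; exact this
          rw [this] at hxob; rcases hxob with h' | h' <;> linarith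
    rw [hg, List.cons_append] at hglue hletg hchg
    have key := foldl_reflect_not_mem_fcc μ₁ (g ++ (e :: l₂'.reverse)) hletg hchg hs₁
      (hobs₁ μ₁ (by rw [hg]; exact List.mem_cons_self))
    rw [hglue] at key
    exact key (mem_fcc_of_mem_fccSlots hs₂)

end Summit.Ventures.Crystal3D.Theorems

end
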